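import Mathlib.Analysis.SpecialFunctions.Pow.Deriv
import Mathlib.Analysis.SpecialFunctions.Sqrt
import Mathlib.Analysis.SpecialFunctions.ExpDeriv
import Mathlib.Analysis.SpecialFunctions.Complex.LogDeriv
import HarnessLib

/-!
# The Liouville–Green approximants `f^{-1/4} exp(σ ∫ f^{1/2})` and Olver's error-control integrand

Topic `Literature/Analysis/ODE` (namespace `Literature.Analysis.ODE`). Everything is proved; no
definitions (the approximants are written out as explicit lambdas so that users may `set` them).

For the equation `w″ = (u² f + g) w` with `f > 0` (F. W. J. Olver, *Asymptotics and Special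
Functions* (1974), Ch. 6 §§1–2, Ch. 10 §3) the LG functions are
`E_σ(x) = f(x)^{-1/4} exp(σ ξ(x))`, `ξ′ = √f`, `σ = ±u`; in the oscillatory case `f < 0` one uses
`(−f)^{-1/4} exp(±iu ∫√(−f))`, i.e. a complex `σ`. The elementary calculus facts about them
consumed by the error analysis (`LiouvilleGreenErrorBound.lean`, `LiouvilleGreenOscillatory.lean`)
are collected here, with one-sided derivatives within an arbitrary set `s`:

* `hasDerivWithinAt_lgExp` / `hasDerivWithinAt_lgCExp` — `E_σ′ = E_σ(−f′/(4f) + σ√f)` and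
  `E_σ″ = (σ²f + 5f′²/(16f²) − f″/(4f)) E_σ`: the LG functions satisfy EXACTLY the comparison
  equation `E″ = (σ² f + g + √f·Φ) E`, `Φ = 5f′²/(16f^{5/2}) − f″/(4f^{3/2}) − g/f^{1/2} = F′`
  (`F` = Olver's error-control function (2.01); Olver Ch. 6 Ex. 1.2);
* `lgExp_wronskian` / `lgCExp_wronskian` — `W(E_{−σ}, E_σ) = 2σ`;
* `lgExp_pos`, `abs_lgExp_mul_abs_lgExp_neg` (`|E_σ||E_{−σ}| = f^{-1/2}`), `norm_lgCExp`
  (`‖E_σ‖ = f^{-1/4}` for `Re σ = 0`);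
* `lgErrorControl_eq_div_sqrt` (`Φ = (5f′²/(16f²) − f″/(4f) − g)/√f`) and
  `continuousOn_lgErrorControl`; the power identity `rpow_neg_quarter_mul_self`.

## References

* F. W. J. Olver, *Asymptotics and Special Functions*, Academic Press 1974, Ch. 6 §1.1–§2.4
  (eqs. (1.05)–(1.08), (2.01), (2.05)–(2.06), Ex. 1.2). Key `Olver1974`.
-/

noncomputable section

namespace Literature.Analysis.ODE

open Set Filter
open scoped _root_.Topology

/-! ## Power identities for `f > 0` -/

/-- `x^{-1/4} · x^{-1/4} = 1/√x` for `x > 0`. [folklore] -/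
theorem rpow_neg_quarter_mul_self {x : ℝ} (hx : 0 < x) :
    x ^ (-(1 / 4 : ℝ)) * x ^ (-(1 / 4 : ℝ)) = (Real.sqrt x)⁻¹ := by
  rw [← Real.rpow_add hx, Real.sqrt_eq_rpow, ← Real.rpow_neg hx.le]
  norm_num

/-- Olver's error-control integrand in terms of `√f`: for `f > 0`,
`5f'²/(16 f^{5/2}) − f''/(4 f^{3/2}) − g/f^{1/2} = (5f'²/(16 f²) − f''/(4f) − g)/√f`. [folklore] -/
theorem lgErrorControl_eq_div_sqrt {F F' F'' G : ℝ} (hF : 0 < F) :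
    5 * F' ^ 2 / (16 * F ^ (5 / 2 : ℝ)) - F'' / (4 * F ^ (3 / 2 : ℝ)) - G / Real.sqrt F =
      (5 * F' ^ 2 / (16 * F ^ 2) - F'' / (4 * F) - G) / Real.sqrt F := by
  have h5 : F ^ (5 / 2 : ℝ) = F ^ 2 * Real.sqrt F := by
    rw [show (5 / 2 : ℝ) = 2 + 1 / 2 by norm_num, Real.rpow_add hF, Real.rpow_two,
      Real.sqrt_eq_rpow]
  have h3 : F ^ (3 / 2 : ℝ) = F * Real.sqrt F := by
    rw [show (3 / 2 : ℝ) = 1 + 1 / 2 by norm_num, Real.rpow_add hF, Real.rpow_one,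
      Real.sqrt_eq_rpow]
  rw [h5, h3]
  have hs : Real.sqrt F ≠ 0 := (Real.sqrt_pos.2 hF).ne'
  field_simp

/-! ## Derivatives of the approximants (real exponent) -/

/-- **The LG approximant solves the comparison equation.** For `f > 0` at `t`, `ξ' = √f` and a
real constant `σ`, the function `E_σ = f^{-1/4} e^{σ ξ}` has, within any set `s`,
`E_σ' = E_σ · (−f'/(4f) + σ√f)` and `(E_σ')' = (σ² f + 5f'²/(16f²) − f''/(4f)) · E_σ`, i.e.
`E_σ'' = (σ² f + g + √f·Φ) E_σ` with `√f Φ = 5f'²/(16f²) − f''/(4f) − g` (Olver 1974, Ch. 6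
§1.1–§2.1: the LG functions satisfy exactly the differential equation obtained by adding
`f^{-1/4} (f^{-1/4})''` to the coefficient). [folklore] -/
theorem hasDerivWithinAt_lgExp {s : Set ℝ} {t : ℝ} {f f' f'' ξ : ℝ → ℝ} (σ : ℝ)
    (hf : HasDerivWithinAt f (f' t) s t) (hf' : HasDerivWithinAt f' (f'' t) s t)
    (hξ : HasDerivWithinAt ξ (Real.sqrt (f t)) s t) (hpos : 0 < f t) :
    HasDerivWithinAt (fun y ↦ f y ^ (-(1 / 4 : ℝ)) * Real.exp (σ * ξ y))
      (f t ^ (-(1 / 4 : ℝ)) * Real.exp (σ * ξ t) * (-f' t / (4 * f t) + σ * Real.sqrt (f t))) s t ∧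
    HasDerivWithinAt
      (fun y ↦ f y ^ (-(1 / 4 : ℝ)) * Real.exp (σ * ξ y) *
        (-f' y / (4 * f y) + σ * Real.sqrt (f y)))
      ((σ ^ 2 * f t + (5 * f' t ^ 2 / (16 * f t ^ 2) - f'' t / (4 * f t))) *
        (f t ^ (-(1 / 4 : ℝ)) * Real.exp (σ * ξ t))) s t := by
  have hf0 : f t ≠ 0 := hpos.ne'
  have hA : HasDerivWithinAt (fun y ↦ f y ^ (-(1 / 4 : ℝ)))
      (f' t * (-(1 / 4 : ℝ)) * (f t ^ (-(1 / 4 : ℝ)) / f t)) s t := by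
    have := hf.rpow_const (p := -(1 / 4 : ℝ)) (Or.inl hf0)
    rwa [Real.rpow_sub_one hf0] at this
  have hB : HasDerivWithinAt (fun y ↦ Real.exp (σ * ξ y))
      (Real.exp (σ * ξ t) * (σ * Real.sqrt (f t))) s t := (hξ.const_mul σ).exp
  have hE : HasDerivWithinAt (fun y ↦ f y ^ (-(1 / 4 : ℝ)) * Real.exp (σ * ξ y))
      (f t ^ (-(1 / 4 : ℝ)) * Real.exp (σ * ξ t) * (-f' t / (4 * f t) + σ * Real.sqrt (f t))) s t :=
    (hA.mul hB).congr_deriv (by field_simp)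
  refine ⟨hE, ?_⟩
  have hs0 : Real.sqrt (f t) ≠ 0 := (Real.sqrt_pos.2 hpos).ne'
  have hL : HasDerivWithinAt (fun y ↦ -f' y / (4 * f y) + σ * Real.sqrt (f y))
      ((-f'' t * (4 * f t) - -f' t * (4 * f' t)) / (4 * f t) ^ 2 +
        σ * (f' t / (2 * Real.sqrt (f t)))) s t :=
    (hf'.neg.div (hf.const_mul 4) (by positivity)).add ((hf.sqrt hf0).const_mul σ)
  refine (hE.mul hL).congr_deriv ?_
  obtain ⟨r, hr0, hr⟩ : ∃ r, 0 < r ∧ Real.sqrt (f t) = r := ⟨_, Real.sqrt_pos.2 hpos, rfl⟩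
  have hr2 : f t = r ^ 2 := by rw [← hr, Real.sq_sqrt hpos.le]
  rw [hr, hr2]
  field_simp
  ring

/-! ## Derivatives of the approximants (complex exponent) -/

/-- **The LG approximant with a complex exponent.** For `f > 0` at `t`, `ξ' = √f` and a complex
constant `σ` (in the oscillatory case `σ = ±iu`), the complex function `E_σ = f^{-1/4} e^{σ ξ}`
has, within any set `s`, `E_σ' = E_σ · (−f'/(4f) + σ√f)` and
`(E_σ')' = (σ² f + 5f'²/(16f²) − f''/(4f)) · E_σ` (Olver 1974, Ch. 6 §2.4, the oscillatory
comparison functions). [folklore] -/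
theorem hasDerivWithinAt_lgCExp {s : Set ℝ} {t : ℝ} {f f' f'' ξ : ℝ → ℝ} (σ : ℂ)
    (hf : HasDerivWithinAt f (f' t) s t) (hf' : HasDerivWithinAt f' (f'' t) s t)
    (hξ : HasDerivWithinAt ξ (Real.sqrt (f t)) s t) (hpos : 0 < f t) :
    HasDerivWithinAt (fun y ↦ ((f y ^ (-(1 / 4 : ℝ)) : ℝ) : ℂ) * Complex.exp (σ * (ξ y : ℂ)))
      (((f t ^ (-(1 / 4 : ℝ)) : ℝ) : ℂ) * Complex.exp (σ * (ξ t : ℂ)) *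
        (((-f' t / (4 * f t) : ℝ) : ℂ) + σ * (Real.sqrt (f t) : ℂ))) s t ∧
    HasDerivWithinAt
      (fun y ↦ ((f y ^ (-(1 / 4 : ℝ)) : ℝ) : ℂ) * Complex.exp (σ * (ξ y : ℂ)) *
        (((-f' y / (4 * f y) : ℝ) : ℂ) + σ * (Real.sqrt (f y) : ℂ)))
      ((σ ^ 2 * (f t : ℂ) + ((5 * f' t ^ 2 / (16 * f t ^ 2) - f'' t / (4 * f t) : ℝ) : ℂ)) *
        (((f t ^ (-(1 / 4 : ℝ)) : ℝ) : ℂ) * Complex.exp (σ * (ξ t : ℂ)))) s t := by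
  have hf0 : f t ≠ 0 := hpos.ne'
  have hA : HasDerivWithinAt (fun y ↦ ((f y ^ (-(1 / 4 : ℝ)) : ℝ) : ℂ))
      ((f' t * (-(1 / 4 : ℝ)) * (f t ^ (-(1 / 4 : ℝ)) / f t) : ℝ) : ℂ) s t := by
    have := hf.rpow_const (p := -(1 / 4 : ℝ)) (Or.inl hf0)
    rw [Real.rpow_sub_one hf0] at this
    exact this.ofReal_comp
  have hB : HasDerivWithinAt (fun y ↦ Complex.exp (σ * (ξ y : ℂ)))
      (Complex.exp (σ * (ξ t : ℂ)) * (σ * (Real.sqrt (f t) : ℂ))) s t :=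
    (hξ.ofReal_comp.const_mul σ).cexp
  have hE : HasDerivWithinAt
      (fun y ↦ ((f y ^ (-(1 / 4 : ℝ)) : ℝ) : ℂ) * Complex.exp (σ * (ξ y : ℂ)))
      (((f t ^ (-(1 / 4 : ℝ)) : ℝ) : ℂ) * Complex.exp (σ * (ξ t : ℂ)) *
        (((-f' t / (4 * f t) : ℝ) : ℂ) + σ * (Real.sqrt (f t) : ℂ))) s t := by
    refine (hA.mul hB).congr_deriv ?_
    have : (f t : ℂ) ≠ 0 := by exact_mod_cast hf0
    push_cast
    field_simp
  refine ⟨hE, ?_⟩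
  have hs0 : Real.sqrt (f t) ≠ 0 := (Real.sqrt_pos.2 hpos).ne'
  have hL : HasDerivWithinAt (fun y ↦ ((-f' y / (4 * f y) : ℝ) : ℂ) + σ * (Real.sqrt (f y) : ℂ))
      ((((-f'' t * (4 * f t) - -f' t * (4 * f' t)) / (4 * f t) ^ 2 : ℝ) : ℂ) +
        σ * ((f' t / (2 * Real.sqrt (f t)) : ℝ) : ℂ)) s t :=
    (hf'.neg.div (hf.const_mul 4) (by positivity)).ofReal_comp.add
      ((hf.sqrt hf0).ofReal_comp.const_mul σ)
  refine (hE.mul hL).congr_deriv ?_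
  obtain ⟨r, hr0, hr⟩ : ∃ r, 0 < r ∧ Real.sqrt (f t) = r := ⟨_, Real.sqrt_pos.2 hpos, rfl⟩
  have hr2 : f t = r ^ 2 := by rw [← hr, Real.sq_sqrt hpos.le]
  rw [hr, hr2]
  have hr0' : (r : ℂ) ≠ 0 := by exact_mod_cast hr0.ne'
  push_cast
  field_simp
  ring

/-! ## Wronskians, signs and sizes of the approximants -/

/-- **Wronskian of the LG pair (real exponent):** `W(E_{−σ}, E_σ) = E_{−σ} E_σ' − E_{−σ}' E_σ = 2σ`
(the product `f^{-1/4} · f^{-1/4} = f^{-1/2}` cancels the factor `√f` of `E_σ'/E_σ − E_{−σ}'/E_{−σ}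
= 2σ√f`). [folklore] -/
theorem lgExp_wronskian {f f' ξ : ℝ → ℝ} {t : ℝ} (σ : ℝ) (hpos : 0 < f t) :
    f t ^ (-(1 / 4 : ℝ)) * Real.exp (-σ * ξ t) *
        (f t ^ (-(1 / 4 : ℝ)) * Real.exp (σ * ξ t) * (-f' t / (4 * f t) + σ * Real.sqrt (f t))) -
      f t ^ (-(1 / 4 : ℝ)) * Real.exp (-σ * ξ t) * (-f' t / (4 * f t) + -σ * Real.sqrt (f t)) *
        (f t ^ (-(1 / 4 : ℝ)) * Real.exp (σ * ξ t)) = 2 * σ := by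
  have hA := rpow_neg_quarter_mul_self hpos
  have hee : Real.exp (-σ * ξ t) * Real.exp (σ * ξ t) = 1 := by
    rw [← Real.exp_add]; simp
  have hs : Real.sqrt (f t) ≠ 0 := (Real.sqrt_pos.2 hpos).ne'
  calc _ = f t ^ (-(1 / 4 : ℝ)) * f t ^ (-(1 / 4 : ℝ)) *
        (Real.exp (-σ * ξ t) * Real.exp (σ * ξ t)) * (2 * σ * Real.sqrt (f t)) := by ring
    _ = 2 * σ := by rw [hA, hee]; field_simp

/-- **Wronskian of the LG pair (complex exponent):** `W(E_{−σ}, E_σ) = 2σ`. [folklore] -/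
theorem lgCExp_wronskian {f f' ξ : ℝ → ℝ} {t : ℝ} (σ : ℂ) (hpos : 0 < f t) :
    ((f t ^ (-(1 / 4 : ℝ)) : ℝ) : ℂ) * Complex.exp (-σ * (ξ t : ℂ)) *
        (((f t ^ (-(1 / 4 : ℝ)) : ℝ) : ℂ) * Complex.exp (σ * (ξ t : ℂ)) *
          (((-f' t / (4 * f t) : ℝ) : ℂ) + σ * (Real.sqrt (f t) : ℂ))) -
      ((f t ^ (-(1 / 4 : ℝ)) : ℝ) : ℂ) * Complex.exp (-σ * (ξ t : ℂ)) *
          (((-f' t / (4 * f t) : ℝ) : ℂ) + -σ * (Real.sqrt (f t) : ℂ)) *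
        (((f t ^ (-(1 / 4 : ℝ)) : ℝ) : ℂ) * Complex.exp (σ * (ξ t : ℂ))) = 2 * σ := by
  have hA : ((f t ^ (-(1 / 4 : ℝ)) : ℝ) : ℂ) * ((f t ^ (-(1 / 4 : ℝ)) : ℝ) : ℂ) =
      ((Real.sqrt (f t) : ℂ))⁻¹ := by
    rw [← Complex.ofReal_mul, rpow_neg_quarter_mul_self hpos, Complex.ofReal_inv]
  have hee : Complex.exp (-σ * (ξ t : ℂ)) * Complex.exp (σ * (ξ t : ℂ)) = 1 := by
    rw [← Complex.exp_add]; simp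
  have hs : (Real.sqrt (f t) : ℂ) ≠ 0 := by exact_mod_cast (Real.sqrt_pos.2 hpos).ne'
  calc _ = ((f t ^ (-(1 / 4 : ℝ)) : ℝ) : ℂ) * ((f t ^ (-(1 / 4 : ℝ)) : ℝ) : ℂ) *
        (Complex.exp (-σ * (ξ t : ℂ)) * Complex.exp (σ * (ξ t : ℂ))) *
        (2 * σ * (Real.sqrt (f t) : ℂ)) := by ring
    _ = 2 * σ := by rw [hA, hee]; field_simp

/-- The real approximant `f^{-1/4} e^{σξ}` is positive where `f > 0`. [folklore] -/
theorem lgExp_pos {f ξ : ℝ → ℝ} {t : ℝ} (σ : ℝ) (hpos : 0 < f t) :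
    0 < f t ^ (-(1 / 4 : ℝ)) * Real.exp (σ * ξ t) :=
  mul_pos (Real.rpow_pos_of_pos hpos _) (Real.exp_pos _)

/-- Sizes of the real LG pair: `|E_σ| · |E_{−σ}| = 1/√f`. [folklore] -/
theorem abs_lgExp_mul_abs_lgExp_neg {f ξ : ℝ → ℝ} {t : ℝ} (σ : ℝ) (hpos : 0 < f t) :
    |f t ^ (-(1 / 4 : ℝ)) * Real.exp (σ * ξ t)| * |f t ^ (-(1 / 4 : ℝ)) * Real.exp (-σ * ξ t)| =
      (Real.sqrt (f t))⁻¹ := by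
  rw [abs_of_pos (lgExp_pos σ hpos), abs_of_pos (lgExp_pos (-σ) hpos)]
  have hee : Real.exp (σ * ξ t) * Real.exp (-σ * ξ t) = 1 := by
    rw [← Real.exp_add]; simp
  calc _ = f t ^ (-(1 / 4 : ℝ)) * f t ^ (-(1 / 4 : ℝ)) *
        (Real.exp (σ * ξ t) * Real.exp (-σ * ξ t)) := by ring
    _ = (Real.sqrt (f t))⁻¹ := by rw [rpow_neg_quarter_mul_self hpos, hee, mul_one]

/-- Sizes of the oscillatory LG pair: for a purely imaginary exponent `σ`,
`‖E_σ‖ = f^{-1/4}`. [folklore] -/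
theorem norm_lgCExp {f ξ : ℝ → ℝ} {t : ℝ} {σ : ℂ} (hσ : σ.re = 0) (hpos : 0 < f t) :
    ‖((f t ^ (-(1 / 4 : ℝ)) : ℝ) : ℂ) * Complex.exp (σ * (ξ t : ℂ))‖ = f t ^ (-(1 / 4 : ℝ)) := by
  rw [norm_mul, Complex.norm_real, Real.norm_eq_abs, abs_of_pos (Real.rpow_pos_of_pos hpos _),
    Complex.norm_exp]
  simp [Complex.mul_re, hσ]

/-! ## Continuity of the error-control integrand -/

/-- Olver's error-control integrand `Φ = 5f'²/(16 f^{5/2}) − f''/(4 f^{3/2}) − g/√f` is continuous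
where `f, f', f'', g` are continuous and `f > 0`. [folklore] -/
theorem continuousOn_lgErrorControl {s : Set ℝ} {f f' f'' g : ℝ → ℝ} (hf : ContinuousOn f s)
    (hf' : ContinuousOn f' s) (hf'' : ContinuousOn f'' s) (hg : ContinuousOn g s)
    (hpos : ∀ t ∈ s, 0 < f t) :
    ContinuousOn (fun t ↦ 5 * f' t ^ 2 / (16 * f t ^ (5 / 2 : ℝ)) -
      f'' t / (4 * f t ^ (3 / 2 : ℝ)) - g t / Real.sqrt (f t)) s := by
  have hne : ∀ t ∈ s, f t ≠ 0 ∨ 0 ≤ (5 / 2 : ℝ) := fun t _ ↦ Or.inr (by norm_num)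
  have hne' : ∀ t ∈ s, f t ≠ 0 ∨ 0 ≤ (3 / 2 : ℝ) := fun t _ ↦ Or.inr (by norm_num)
  refine ((ContinuousOn.div ((hf'.pow 2).const_smul (5 : ℝ) |>.congr fun t _ ↦ by simp)
    (continuousOn_const.mul (hf.rpow_const hne)) fun t ht ↦ ?_).sub
    (hf''.div (continuousOn_const.mul (hf.rpow_const hne')) fun t ht ↦ ?_)).sub
    (hg.div hf.sqrt fun t ht ↦ (Real.sqrt_pos.2 (hpos t ht)).ne')
  · exact mul_ne_zero (by norm_num) (Real.rpow_pos_of_pos (hpos t ht) _).ne'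
  · exact mul_ne_zero (by norm_num) (Real.rpow_pos_of_pos (hpos t ht) _).ne'

end Literature.Analysis.ODE
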